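import Summits.Schanuel.Schanuel.Theorems.RootDecomp1ERadixCell05

/-!
# RootDecomp1ERadixCell — lens 2, generation 42 «THE FINITE-ORDER RADIX-2 CELL: count CONJUGATES, not degree» (lanes E-R19 (i) T below hyper + (iii) the transcendental weight log 2): S ITSELF on the pure-radix class {z_l = (v_l·log 2)·T^{e_l}, T real of FIXED finite exponential order} HYPOTHESIS-FREE and on the mixed radix class {z_l = (u_l + v_l log 2)·T^{e_l}} mod the ONE tree fact hX = ExplicitRatExpApprox — the Kummer-direction degree is paid by COUNTING the 𝔐 conjugates of 2^{1/𝔐} through the resultant norm Res_Y(Y^𝔐 − 2, F), never by a pair measure — continuation (RootDecomp1ERadixCell06): §5b THE MIXED ENGINE `algebraicIndependent_radixPt` (mod hX)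

(lens-2 g42 HOME kernel RadixCell.lean d9530aae…, 1851 l, imports tree RootDecomp1EUntwistedWall04 + RootDecomp1KFiniteOrderCell02 only; CLAIM L2067, ACK + CHECKLIST E-g42 L2069, NODE L2089 / REQUEST L2090, critic VERDICT L2095 (crit g8: CLEARED — ONE CELL, tiers 1+2 = one cell; lens-2 tally CELL ×4 (g37, g39, g41, g42); E-R20 closes the radix line; PORT GO `--supports stmt-Schanuel-31410`); port by census-1 gen 18 as `RootDecomp1ERadixCell01`–`08` along K's sections: 01 = §1 the radix field ℚ(2^{1/𝔐}) (`croot`, `zroot`, `broot`, `irreducible_X_pow_sub_two`, degree 𝔐); 02 = §2 the two-level polynomial, conjugate factors `Gfac`, the RESULTANT NORM `resNorm` (`map_resNorm` = ∏ conjugates, `resNorm_ne_zero`, degree / value / Mahler-measure bounds); 03 = §3 the radix curve point `radixPt`, germs, fibres, root and residue avoidance at transcendental parameters; 04 = §4 integral exponents at the collapse (`Mden`, `Aexp`, `Bexp`, the value of G₀, from avoidance to the hypotheses of `resNorm_ne_zero`); 05 = §5 THE PURE-RADIX ENGINE `algebraicIndependent_radixPt_pure` (hypothesis-free, `endgame_pure`)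 + §5b mixed-engine helpers; 06 = §5b THE MIXED ENGINE `algebraicIndependent_radixPt (hX)` (one 320-line theorem, scoped `maxHeartbeats 800000` carried as in K); 07 = §6 classes `InPureRadixClass` / `InRadixClass`, `schanuel_inPureRadixClass` (hyp-free) / `schanuel_inRadixClass (hX)`, cells `cell_31410(_pure)` / `cell_25020(_pure)`, members `zLog2Curve` / `zMix` at tower numbers; 08 = §6 items AT the members + separation (`zMix_not_inPointClass`, `zLog2Curve_not_inPointClass`, `zMix_separation`).
PORT EDITS: 37 one-line docstrings added; five generic helpers made `private` against dedup twins (`mahlerMeasure_finset_prod`, `eval_map_intCast`, `aeval_ne_zero_of_transcendental`, `addNat_eq_natAdd`, `transcendental_log_two` ≡ tree AclSubsetLogFreeCore/Negative) with per-part private copies; statements and proofs verbatim; after the dedup bounce of 05 (p828625: `exists_int_relation` ≡ tree `RootDecomp1BRadicalDescent.exists_int_relation`, RadicalDescent03) K's copy was DELETED and the tree declaration is reused via `import …RootDecomp1BRadicalDescent03` + `open … (exists_int_relation)` in 05/06. `--supports stmt-Schanuel-31410`; no census credit carried; rung 0 — nothing here proves Schanuel.)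
-/

noncomputable section

open Complex Polynomial IntermediateField Filter
open scoped BigOperators Topology

namespace Summit.Schanuel.Schanuel.Theorems.RootDecomp1ERadixCell

open Summit.Schanuel.Schanuel.Theorems.RootDecomp1EUntwistedWall (gι gaussPt expo coef tail fib IsZ wden wden_pos
  isZ_expo Wb Wb_nonneg abs_expo_le abs_coef_le expo_eq_of_tail_eq sum_coef_fibre_cast fib_ne_zero diffPoly
  diffPoly_ne_zero eval_diffPoly gι_expo_sub gι_injective tail_eq_of_expo_eq eq_of_tail_eq_of_zero_eq coef_cast
  IsZ.add IsZ.mul IsZ.natCast IsZ.sum isZ_wden_fst isZ_wden_snd InGaussCurveClass)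
open Summit.Schanuel.Schanuel.Theorems.RootDecomp1EPointTransfer (InPointClass)
open Summit.Schanuel.Schanuel.Theorems.RootDecomp1ETwoScale (InTwoScaleClass)
open Summit.Schanuel.Schanuel.Theorems.RootDecomp1EWallDichotomy (InTwistedFrameClass)
open Summit.Schanuel.Schanuel.Theorems.RootDecomp1KHyper
open Summit.Schanuel.Schanuel.Theorems.RootDecomp1KHyper.HyperCell
open Summit.Schanuel.Schanuel.Theorems.RootDecomp1KGeneric (LiouvilleOrder)
open Summit.Schanuel.Schanuel.Theorems.RootDecomp1KFiniteOrderCell (towerNumber liouvilleOrder_towerNumber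
  not_hyperLiouville_towerNumber towerNumber_pos not_liouvilleOrder_towerNumber)
open Summit.Schanuel.Schanuel.Theorems.RootDecomp1BDefectFloorCells (natCast_le_trdeg_of_algebraicIndependent)

open Summit.Schanuel.Schanuel.Theorems.RootDecomp1BRadicalDescent (exists_int_relation)

section MixedEngine

variable {n : ℕ}

/-- `eval x (P.map (Int.castRingHom ℂ)) = aeval x P` for an integer polynomial `P`. -/
private theorem eval_map_intCast (P : ℤ[X]) (x : ℂ) : (P.map (Int.castRingHom ℂ)).eval x = aeval x P := by
  rw [Polynomial.eval_map, Polynomial.aeval_def, algebraMap_int_eq]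

/-- Each exponent of a support monomial is at most the total degree (tree one-liner, private copy). -/
private theorem apply_le_totalDegree' {P : MvPolynomial (Fin (n + 1)) ℤ} {s : Fin (n + 1) →₀ ℕ}
    (hs : s ∈ P.support) (i : Fin (n + 1)) : s i ≤ P.totalDegree := by
  refine le_trans ?_ (MvPolynomial.le_totalDegree hs)
  by_cases hi : i ∈ s.support
  · exact Finset.single_le_sum (f := fun j => s j) (fun _ _ => Nat.zero_le _) hi
  · simp [Finsupp.notMem_support_iff.mp hi]

/-- A non-zero integer polynomial has Mahler measure `≥ 1` (re-proof of the private tree lemma in RootDecomp1KHyper06). -/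
private theorem one_le_mahlerMeasure_map_of_ne_zero' {R : ℤ[X]} (hR : R ≠ 0) :
    1 ≤ (R.map (Int.castRingHom ℂ)).mahlerMeasure := by
  refine one_le_mahlerMeasure_of_one_le_norm_leadingCoeff ?_
  rw [Polynomial.leadingCoeff_map_of_injective (RingHom.injective_int _), eq_intCast,
    Complex.norm_intCast]
  exact_mod_cast Int.one_le_abs (Polynomial.leadingCoeff_ne_zero.mpr hR)

/-- `M(Q) ≤ M(A)` for `Q ∣ A ≠ 0` in `ℤ[X]` (tree-private in the lineage files; re-proved). -/
private theorem mahlerMeasure_le_of_dvd' {Q A : ℤ[X]} (hdvd : Q ∣ A) (hA : A ≠ 0) :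
    (Q.map (Int.castRingHom ℂ)).mahlerMeasure ≤ (A.map (Int.castRingHom ℂ)).mahlerMeasure := by
  obtain ⟨R, rfl⟩ := hdvd
  have hR : R ≠ 0 := right_ne_zero_of_mul hA
  rw [Polynomial.map_mul, mahlerMeasure_mul]
  calc (Q.map (Int.castRingHom ℂ)).mahlerMeasure = (Q.map (Int.castRingHom ℂ)).mahlerMeasure * 1 :=
        (mul_one _).symm
    _ ≤ _ := mul_le_mul_of_nonneg_left (one_le_mahlerMeasure_map_of_ne_zero' hR) (mahlerMeasure_nonneg _)

set_option maxHeartbeats 800000 in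
/-- **THE MIXED RADIX ENGINE (E-g42, Tier 2) mod `hX = ExplicitRatExpApprox` ONLY.**
For `T > 0` real of exponential order `13·Σ_l e_l + 4`, rational `u_l, v_l ≥ 0` (`v_l = 0` where `e_l = 0`)
with the monomials `(u_l + i v_l) X^{e_l}` `ℤ`-free: `T, e^{u₁T^{e₁}}2^{v₁T^{e₁}}, …, e^{u_nT^{e_n}}2^{v_nT^{e_n}}`
are algebraically independent over `ℚ`.  The resultant norm `R₀ ∈ ℤ[x]` of §2 is now a genuine polynomial
in `x = e^{1/𝔐}`: a root `ξ` with `‖x − ξ‖^{deg R₀} ≤ ‖R₀(x)‖ ≤ M(q^Dc)^𝔐·e^{−q^m}`, its irreducible factor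
`Q ∣ R₀` (`deg Q ≤ 𝔐²DW ≲ q^{2K}`, `log M(Q) ≲ q^{K+1}`), and `hX` at the rational exponent `1/𝔐`
(`C₀(1/𝔐) ≲ 𝔐² ≲ q^{2K}`): measure `≲ q^{11K+1}` against `q^{13K+4}` — `endgame_gen` BY NAME. -/
theorem algebraicIndependent_radixPt (hX : ExplicitRatExpApprox) (w : Fin n → ℚ × ℚ) (e : Fin n → ℕ)
    {T : ℝ} (hT0 : 0 < T) (hT : LiouvilleOrder (13 * (∑ l, e l) + 4) T) (hu : ∀ l, 0 ≤ (w l).1)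
    (hv : ∀ l, 0 ≤ (w l).2) (hv0 : ∀ l, e l = 0 → (w l).2 = 0)
    (hLI : LinearIndependent ℤ (fun l : Fin n => Polynomial.monomial (e l) (gι (w l)))) :
    AlgebraicIndependent ℚ (radixPt w e (T : ℂ)) := by
  classical
  by_contra hdep
  obtain ⟨P, hP0, hPu⟩ := exists_int_relation hdep
  have hFT : FR P w e T = 0 := by rw [FR_eq_aeval]; exact hPu
  set D : ℕ := P.totalDegree with hDdef
  have hD : ∀ s ∈ P.support, ∀ i, s i ≤ D := fun s hs i => apply_le_totalDegree' hs i
  have hD0 : ∀ s ∈ P.support, s 0 ≤ D := fun s hs => hD s hs 0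
  obtain ⟨t, ht⟩ : ∃ t, t ∈ P.support := by
    obtain ⟨t, ht⟩ := MvPolynomial.ne_zero_iff.mp hP0
    exact ⟨t, MvPolynomial.mem_support_iff.mpr ht⟩
  have hTt : Transcendental ℚ T := transcendental_of_liouvilleOrder (by omega) hT
  -- ROOT AND RESIDUE AVOIDANCE, eventually near `T`
  set pairs : Finset ((Fin n → ℕ) × (Fin n → ℕ)) :=
    ((P.support.image tail) ×ˢ (P.support.image tail)).filter (fun p => p.1 ≠ p.2) with hpairs
  have hev : ∀ᶠ x : ℝ in 𝓝 T, aeval x (fib P (tail t)) ≠ 0 ∧ ∀ p ∈ pairs,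
      (aeval x (Δ1 w e p.1 p.2) ≠ 0 ∨ aeval x (Δ2 w e p.1 p.2) ∉ Set.range (Int.cast : ℤ → ℝ)) := by
    refine (eventually_fib_ne_zero P ht hTt).and ?_
    rw [Filter.eventually_all_finset]
    intro p hp
    exact eventually_avoid hLI hv0 hTt (Finset.mem_filter.mp hp).2
  obtain ⟨δ₀, hδ₀, hball⟩ := Metric.eventually_nhds_iff.mp hev
  obtain ⟨Kl, δ₁, hKl0, hδ₁, hlip⟩ := exists_lipschitz_FR P w e T
  set M : ℝ := Kl + 1 with hM
  have hM0 : 0 < M := by rw [hM]; linarith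
  -- constants (depend on `T, w, e, P` only)
  set K : ℕ := ∑ l, e l with hK
  set R : ℝ := T + 2 with hR
  have hR1 : 1 ≤ R := by rw [hR]; linarith
  have hR0 : 0 ≤ R := by linarith
  set Lr : ℝ := ∑ s ∈ P.support, |((MvPolynomial.coeff s P : ℤ) : ℝ)| with hLr
  have hLr0 : 0 ≤ Lr := Finset.sum_nonneg fun s _ => abs_nonneg _
  have hWb0 : 0 ≤ Wb w e R := Wb_nonneg w e hR0
  set cG : ℝ := Lr * (R ^ D * Real.exp ((D : ℝ) * Wb w e R)) + 1 with hcG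
  have hcGm : 0 ≤ Lr * (R ^ D * Real.exp ((D : ℝ) * Wb w e R)) := by positivity
  have hcG1 : 1 ≤ cG := by rw [hcG]; linarith
  set wd : ℝ := (wden w : ℝ) with hwd
  have hwd1 : 1 ≤ wd := by rw [hwd]; exact_mod_cast wden_pos w
  have hDr0 : (0 : ℝ) ≤ D := Nat.cast_nonneg D
  set cN : ℝ := wd ^ 2 * (D * Wb w e R) + 1 with hcN
  have hcNm : 0 ≤ wd ^ 2 * (D * Wb w e R) := by positivity
  have hcN1 : 1 ≤ cN := by rw [hcN]; linarith
  have hcN0 : 0 ≤ cN := by linarith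
  set c0 : ℝ := 1280000000 * 4 * 27 ^ 2 with hc0
  set cY : ℝ := 3 + wd * (D + cG) with hcY
  have hcY0 : 0 ≤ cY := by positivity
  set c : ℝ := c0 * wd ^ 2 * (cN ^ 2 * (1 + cN) ^ 2) * cY with hc
  have hc0' : 0 ≤ c := by positivity
  set C : ℝ := cN * c + M + 1 + (wd * (D + cG) + 1) + |Real.log δ₀| + |Real.log δ₁| + |Real.log T| with hC
  have habs0 := abs_nonneg (Real.log δ₀)
  have habs1 := abs_nonneg (Real.log δ₁)
  have habsT := abs_nonneg (Real.log T)
  have hwdc : 0 ≤ wd * (D + cG) := by positivity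
  have hcNc : 0 ≤ cN * c := by positivity
  have hCend : cN * c + ((0 : ℕ) : ℝ) + M + 1 ≤ C := by rw [hC, Nat.cast_zero]; linarith
  have hCpure : M + wd * (D + cG) ≤ C := by rw [hC]; linarith
  have hCwd : wd * (D + cG) + 1 ≤ C := by rw [hC]; linarith
  have hC0 : 0 ≤ C := by linarith
  -- THE APPROXIMANT `r = p/q`: `q ≥ ⌈C⌉ + 2`, `|T − r| < exp(−q^{13K+4})`
  obtain ⟨r, hden, hne, hlt⟩ := hT (⌈C⌉₊ + 2)
  set q : ℕ := r.den with hq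
  have hq2 : 2 ≤ q := le_trans (by omega) hden
  have hq1 : 1 ≤ q := by omega
  have hq1r : (1 : ℝ) ≤ q := by exact_mod_cast hq1
  have hCq : C ≤ (q : ℝ) := by
    have h1 : ((⌈C⌉₊ + 2 : ℕ) : ℝ) ≤ q := by exact_mod_cast hden
    push_cast at h1
    linarith [Nat.le_ceil C]
  set η : ℝ := |T - r| with hη
  have hη0 : 0 < η := abs_pos.mpr (sub_ne_zero.mpr hne)
  have hηlt : η < Real.exp (-((q : ℝ) ^ (13 * K + 4))) := hlt
  have hqm1 : (q : ℝ) ≤ (q : ℝ) ^ (13 * K + 4) := le_self_pow₀ hq1r (by omega)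
  have hηC : η < Real.exp (-C) := hηlt.trans_le (Real.exp_le_exp.mpr (by linarith))
  have hηδ₀ : η < δ₀ := lt_of_abs_log_le hηC hδ₀ (by rw [hC]; linarith)
  have hηδ₁ : η < δ₁ := lt_of_abs_log_le hηC hδ₁ (by rw [hC]; linarith)
  have hηT : η < T := lt_of_abs_log_le hηC hT0 (by rw [hC]; linarith)
  have hη1 : η ≤ 1 := hηC.le.trans (by rw [Real.exp_le_one_iff]; linarith)
  have hr0 : 0 < r := by
    have h1 := abs_lt.mp (show |T - r| < T from hηT)
    exact_mod_cast (show (0 : ℝ) < r by linarith [h1.2])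
  have hr0' : 0 ≤ r := hr0.le
  have hrR : |(r : ℝ)| ≤ R := by
    have h1 : |(r : ℝ)| ≤ |T| + |T - r| := by
      calc |(r : ℝ)| = |T - (T - r)| := by ring_nf
        _ ≤ |T| + |T - r| := abs_sub _ _
    rw [abs_of_pos hT0] at h1
    rw [hR]; linarith
  -- avoidance AT `r`
  obtain ⟨hfibr, havr⟩ := hball (show dist (r : ℝ) T < δ₀ by rw [Real.dist_eq, abs_sub_comm]; exact hηδ₀)
  have hav : AvoidAt P w e r := by
    intro s hs s' hs' hne'
    have hp : (tail s, tail s') ∈ pairs := Finset.mem_filter.mpr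
      ⟨Finset.mem_product.mpr ⟨Finset.mem_image_of_mem _ hs, Finset.mem_image_of_mem _ hs'⟩, hne'⟩
    rcases havr _ hp with h1 | h2
    · left; intro h0; apply h1; rw [aeval_ratCast, h0, Rat.cast_zero]
    · right; rintro ⟨z, hz⟩; apply h2; exact ⟨z, by rw [aeval_ratCast, hz, Rat.cast_intCast]⟩
  -- THE RESULTANT NORM `R₀ ∈ ℤ[X]`, non-zero
  have hMn0 : 0 < Mden w e r := Mden_pos w e r
  set R₀ : ℤ[X] := resNorm (Mden w e r) P.support (coef P D r) (Aexp w e r) (Bexp w e r) with hR₀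
  have hres := hres_of_avoid hu hv hr0' hav ht
  have hsum := hsum_of_avoid P hD0 hu hv hr0' hav ht hfibr
  have hR0ne : R₀ ≠ 0 := resNorm_ne_zero hMn0 hres hsum
  set x : ℝ := Real.exp (((Mden w e r : ℕ) : ℝ)⁻¹) with hx
  -- SIZES: `𝔐 ≤ wd q^K`, `deg R₀ ≤ 𝔐·A_max ≤ cN q^{2K}`
  have hMn : ((Mden w e r : ℕ) : ℝ) ≤ wd * (q : ℝ) ^ K := by
    rw [Mden, hwd, hq, ← hK]; push_cast; exact le_rfl
  have hMnE : ((Mden w e r : ℕ) : ℝ) = wd * (q : ℝ) ^ K := by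
    rw [Mden, hwd, hq, ← hK]; push_cast; rfl
  have hAreal : ∀ s ∈ P.support, (Aexp w e r s : ℝ) ≤ (Mden w e r : ℝ) * (D * Wb w e R) := by
    intro s hs
    have h1 : ((Aexp w e r s : ℕ) : ℝ) = ((Mden w e r : ℕ) : ℝ) * ((expo w e r s).1 : ℝ) := by
      exact_mod_cast Aexp_cast hu e hr0' s
    rw [h1]
    refine mul_le_mul_of_nonneg_left ?_ (Nat.cast_nonneg _)
    have hb := abs_expo_le w e hrR (hD s hs)
    linarith [le_abs_self ((expo w e r s).1 : ℝ), abs_nonneg ((expo w e r s).2 : ℝ)]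
  set Asup : ℕ := ⌊((Mden w e r : ℕ) : ℝ) * (D * Wb w e R)⌋₊ with hAsup
  have hAle : ∀ s ∈ P.support, Aexp w e r s ≤ Asup := fun s hs => Nat.le_floor (hAreal s hs)
  set Kb : ℕ := Mden w e r * Asup with hKb
  have hNdeg : R₀.natDegree ≤ Kb := natDegree_resNorm_le hMn0 (coef P D r) (Bexp w e r) hAle
  have hKbr : (Kb : ℝ) ≤ cN * (q : ℝ) ^ (2 * K) := by
    rw [hKb, Nat.cast_mul]
    have h1 : (Asup : ℝ) ≤ ((Mden w e r : ℕ) : ℝ) * (D * Wb w e R) := Nat.floor_le (by positivity)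
    calc ((Mden w e r : ℕ) : ℝ) * (Asup : ℝ) ≤ (wd * (q : ℝ) ^ K) * ((wd * (q : ℝ) ^ K) * (D * Wb w e R)) := by
          rw [← hMnE]; exact mul_le_mul_of_nonneg_left h1 (Nat.cast_nonneg _)
      _ = (wd ^ 2 * (D * Wb w e R)) * (q : ℝ) ^ (2 * K) := by ring
      _ ≤ cN * (q : ℝ) ^ (2 * K) := mul_le_mul_of_nonneg_right (by rw [hcN]; linarith) (by positivity)
  have hNA : (R₀.natDegree : ℝ) ≤ cN * (q : ℝ) ^ (2 * K) := le_trans (by exact_mod_cast hNdeg) hKbr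
  -- TERM BOUNDS: `|coef_s| ≤ |P_s| R^D q^D`, `e^{ρ(expo_s)}, 2^{(expo_s).2} ≤ e^{D·W}`
  have hl2 : Real.log 2 ≤ 1 := by
    have := Real.log_le_sub_one_of_pos (x := 2) two_pos; linarith
  have hexpo2 : ∀ s ∈ P.support, ((expo w e r s).2 : ℝ) * Real.log 2 ≤ (D : ℝ) * Wb w e R ∧
      ρr (expo w e r s) ≤ (D : ℝ) * Wb w e R := by
    intro s hs
    have hb := abs_expo_le w e hrR (hD s hs)
    have h2nn : (0 : ℝ) ≤ ((expo w e r s).2 : ℝ) := by exact_mod_cast expo_snd_nonneg hv e hr0' s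
    have h1le : ((expo w e r s).1 : ℝ) ≤ |((expo w e r s).1 : ℝ)| := le_abs_self _
    have h2le : ((expo w e r s).2 : ℝ) * Real.log 2 ≤ |((expo w e r s).2 : ℝ)| := by
      rw [abs_of_nonneg h2nn]
      calc ((expo w e r s).2 : ℝ) * Real.log 2 ≤ ((expo w e r s).2 : ℝ) * 1 :=
            mul_le_mul_of_nonneg_left hl2 h2nn
        _ = _ := mul_one _
    refine ⟨by linarith [abs_nonneg ((expo w e r s).1 : ℝ)], by rw [ρr]; linarith⟩
  have hsum_bound : ∀ f : (Fin (n + 1) →₀ ℕ) → ℝ, (∀ s ∈ P.support, 0 ≤ f s) →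
      (∀ s ∈ P.support, f s ≤ Real.exp ((D : ℝ) * Wb w e R)) →
      ∑ s ∈ P.support, |(coef P D r s : ℝ)| * f s ≤ (q : ℝ) ^ D * cG := by
    intro f hf0 hf
    have hterm : ∀ s ∈ P.support, |(coef P D r s : ℝ)| * f s ≤
        |((MvPolynomial.coeff s P : ℤ) : ℝ)| * (R ^ D * (q : ℝ) ^ D) * Real.exp ((D : ℝ) * Wb w e R) :=
      fun s hs => mul_le_mul (abs_coef_le P hR1 hrR (hD0 s hs)) (hf s hs) (hf0 s hs) (by positivity)
    refine (Finset.sum_le_sum hterm).trans ?_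
    rw [← Finset.sum_mul, ← Finset.sum_mul, ← hLr]
    have : Lr * (R ^ D * (q : ℝ) ^ D) * Real.exp ((D : ℝ) * Wb w e R) =
        (q : ℝ) ^ D * (Lr * (R ^ D * Real.exp ((D : ℝ) * Wb w e R))) := by ring
    rw [this]
    exact mul_le_mul_of_nonneg_left (by rw [hcG]; linarith) (by positivity)
  -- height `Σ_s |coef_s| c^{B'_s} ≤ q^D c_G` and conjugate sizes `‖G_i(x)‖ ≤ q^D c_G`
  have hH : ∑ s ∈ P.support, |(coef P D r s : ℝ)| * croot (Mden w e r) ^ Bexp w e r s ≤ (q : ℝ) ^ D * cG := by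
    rw [height_Gfac_collapse_eq P D hv e hr0']
    exact hsum_bound _ (fun s _ => (Real.exp_pos _).le) fun s hs => Real.exp_le_exp.mpr (hexpo2 s hs).1
  set Gn : ℕ → ℝ := fun i =>
    ‖(Gfac (Mden w e r) P.support (coef P D r) (Aexp w e r) (Bexp w e r) i).eval (x : ℂ)‖ with hGn
  have hGn0 : ∀ i, 0 ≤ Gn i := fun i => norm_nonneg _
  have hGi : ∀ i, Gn i ≤ (q : ℝ) ^ D * cG := fun i =>
    (norm_eval_Gfac_collapse_le P D hu hv e hr0' i).trans
      (hsum_bound _ (fun s _ => (Real.exp_pos _).le) fun s hs => Real.exp_le_exp.mpr (hexpo2 s hs).2)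
  have hG0 : Gn 0 ≤ (q : ℝ) ^ D * M * η := by
    show ‖(Gfac (Mden w e r) P.support (coef P D r) (Aexp w e r) (Bexp w e r) 0).eval (x : ℂ)‖ ≤ _
    rw [hx, eval_Gfac_zero P hD0 hu hv e hr0', norm_mul, norm_pow, Complex.norm_natCast]
    have h1 : ‖FR P w e r‖ ≤ M * η := by
      have h2 := hlip r (by rw [abs_sub_comm]; exact hηδ₁)
      rw [hFT, sub_zero, abs_sub_comm] at h2
      calc ‖FR P w e r‖ ≤ Kl * η := h2
        _ ≤ M * η := mul_le_mul_of_nonneg_right (by rw [hM]; linarith) hη0.le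
    calc (r.den : ℝ) ^ D * ‖FR P w e r‖ ≤ (q : ℝ) ^ D * (M * η) := by rw [hq]; gcongr
      _ = (q : ℝ) ^ D * M * η := by ring
  have hup : ‖aeval (x : ℂ) R₀‖ ≤ M * ((q : ℝ) ^ D * cG) ^ (Mden w e r) * η := by
    rw [hR₀, norm_aeval_resNorm hMn0]
    change ∏ i ∈ Finset.range (Mden w e r), Gn i ≤ _
    obtain ⟨k, hk⟩ := Nat.exists_eq_succ_of_ne_zero hMn0.ne'
    have hsplit : ∏ i ∈ Finset.range (Mden w e r), Gn i = (∏ i ∈ Finset.range k, Gn (i + 1)) * Gn 0 := by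
      rw [show Finset.range (Mden w e r) = Finset.range (k + 1) by rw [hk], Finset.prod_range_succ']
    have hP : ∏ i ∈ Finset.range k, Gn (i + 1) ≤ ((q : ℝ) ^ D * cG) ^ k := by
      refine (Finset.prod_le_prod (fun i _ => hGn0 _) fun i _ => hGi (i + 1)).trans ?_
      rw [Finset.prod_const, Finset.card_range]
    have hqD : (q : ℝ) ^ D ≤ (q : ℝ) ^ D * cG := le_mul_of_one_le_right (by positivity) hcG1
    rw [hsplit]
    calc (∏ i ∈ Finset.range k, Gn (i + 1)) * Gn 0
        ≤ ((q : ℝ) ^ D * cG) ^ k * ((q : ℝ) ^ D * M * η) := mul_le_mul hP hG0 (hGn0 0) (by positivity)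
      _ ≤ ((q : ℝ) ^ D * cG) ^ k * (((q : ℝ) ^ D * cG) * M * η) := by gcongr
      _ = M * ((q : ℝ) ^ D * cG) ^ (k + 1) * η := by ring
      _ = M * ((q : ℝ) ^ D * cG) ^ (Mden w e r) * η := by rw [hk]
  -- CONSTANT BRANCH (`deg R₀ = 0`): the pure endgame
  rcases Nat.eq_zero_or_pos R₀.natDegree with hdeg | hNpos
  · have hlow : (1 : ℝ) ≤ ‖aeval (x : ℂ) R₀‖ := by
      have ha : R₀ = Polynomial.C (R₀.coeff 0) := Polynomial.eq_C_of_natDegree_eq_zero hdeg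
      have ha0 : R₀.coeff 0 ≠ 0 := fun h => hR0ne (by rw [ha, h, map_zero])
      rw [ha, aeval_C, algebraMap_int_eq, eq_intCast, Complex.norm_intCast]
      exact_mod_cast Int.one_le_abs ha0
    exact endgame_pure hq2 hM0 hcG1 hwd1 hMn (by omega : K + 2 ≤ 13 * K + 4) (hCpure.trans hCq) hηlt
      (hlow.trans hup)
  -- A ROOT `ξ` of `R₀` with `‖x − ξ‖^{deg R₀} ≤ ‖R₀(x)‖`
  set RC : ℂ[X] := R₀.map (Int.castRingHom ℂ) with hRC
  have hRCdeg : RC.natDegree = R₀.natDegree := by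
    rw [hRC, Polynomial.natDegree_map_eq_of_injective (RingHom.injective_int _)]
  have hRClead : 1 ≤ ‖RC.leadingCoeff‖ := by
    rw [hRC, Polynomial.leadingCoeff_map_of_injective (RingHom.injective_int _), eq_intCast,
      Complex.norm_intCast]
    exact_mod_cast Int.one_le_abs (Polynomial.leadingCoeff_ne_zero.mpr hR0ne)
  obtain ⟨ξ, hξroot, hξle⟩ := exists_root_pow_le_norm_eval RC hRClead (by rw [hRCdeg]; exact hNpos) (x : ℂ)
  rw [hRCdeg, hRC, eval_map_intCast] at hξle
  have hR0ξ : aeval ξ R₀ = 0 := by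
    have h := hξroot
    rw [Polynomial.IsRoot.def, hRC, eval_map_intCast] at h
    exact h
  -- the irreducible factor `Q ∣ R₀` at `ξ`
  have hξalg : IsAlgebraic ℚ ξ := (IsFractionRing.isAlgebraic_iff ℤ ℚ ℂ).mp ⟨R₀, hR0ne, hR0ξ⟩
  obtain ⟨Q, hQirr, hQdeg, hQξ⟩ :=
    Literature.NumberTheory.Transcendental.NesterenkoWaldschmidt1996.exists_irreducible_int_aeval_eq_zero hξalg
  have hQR : Q ∣ R₀ := dvd_of_irreducible_of_common_root hQirr hQdeg hQξ hR0ξ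
  have hnR : Q.natDegree ≤ R₀.natDegree := Polynomial.natDegree_le_of_dvd hQR hR0ne
  have hnKb : Q.natDegree ≤ Kb := hnR.trans hNdeg
  -- heights: `M(Q) ≤ M(R₀) ≤ (q^D c_G)^𝔐`, `Y := log 16 + wd·q^K·(D + c_G)·q ≤ cY q^{K+1}`
  have hMR : (R₀.map (Int.castRingHom ℂ)).mahlerMeasure ≤ ((q : ℝ) ^ D * cG) ^ (Mden w e r) :=
    mahlerMeasure_resNorm_le hMn0 _ _ _ _ hH
  have hLexp : ((q : ℝ) ^ D * cG) ^ (Mden w e r) ≤ Real.exp (wd * (q : ℝ) ^ K * ((D + cG) * q)) :=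
    pow_collapse_le_exp hq1 hcG1 hMn
  set Y : ℝ := Real.log 16 + wd * (q : ℝ) ^ K * ((D + cG) * q) with hY
  have hlog16 : 0 ≤ Real.log 16 := Real.log_nonneg (by norm_num)
  have hYm : 0 ≤ wd * (q : ℝ) ^ K * ((D + cG) * q) := by positivity
  have h16Y : Real.log 16 ≤ Y := by rw [hY]; linarith
  have hMQY : Real.log (Q.map (Int.castRingHom ℂ)).mahlerMeasure ≤ Y := by
    have hMpos : 0 < (Q.map (Int.castRingHom ℂ)).mahlerMeasure :=
      mahlerMeasure_pos_of_ne_zero ((Polynomial.map_ne_zero_iff (RingHom.injective_int _)).mpr hQirr.ne_zero)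
    have h1 := Real.log_le_log hMpos (((mahlerMeasure_le_of_dvd' hQR hR0ne).trans hMR).trans hLexp)
    rw [Real.log_exp] at h1
    rw [hY]; linarith
  have hYq : Y ≤ cY * (q : ℝ) ^ (K + 1) := by
    have h1 : Real.log 16 ≤ 3 * (q : ℝ) ^ (K + 1) := by
      linarith [log_sixteen_lt_three, one_le_pow₀ (n := K + 1) hq1r]
    have h2 : wd * (q : ℝ) ^ K * ((D + cG) * q) = wd * (D + cG) * (q : ℝ) ^ (K + 1) := by ring
    rw [hY, hcY, h2, add_mul]; linarith
  -- THE MEASURE at the rational exponent `1/𝔐`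
  set r' : ℚ := ((Mden w e r : ℕ) : ℚ)⁻¹ with hr'
  have hr'0 : r' ≠ 0 := by rw [hr']; exact inv_ne_zero (by exact_mod_cast hMn0.ne')
  have hr'C : cexp (r' : ℂ) = (x : ℂ) := by
    rw [hr', hx, Complex.ofReal_exp]; push_cast; rfl
  have hr'den : (r'.den : ℝ) = ((Mden w e r : ℕ) : ℝ) := by
    rw [hr', Rat.inv_natCast_den, if_neg hMn0.ne']
  have hXr := hX r' hr'0 Q hQirr hQdeg ξ hQξ Y h16Y hMQY
  rw [hr'C] at hXr
  -- `Φ ≤ c q^{11K+1}`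
  have hΦ : C₀rat r' * (Q.natDegree : ℝ) ^ 2 * Y *
      (Real.log Y + Real.log Q.natDegree) ^ 2 / Real.log Y ^ 2 ≤ c * (q : ℝ) ^ (11 * K + 1) := by
    have h1 : C₀rat r' ≤ c0 * wd ^ 2 * (q : ℝ) ^ (2 * K) := by
      have h := C₀rat_le (ρ := 0) (r := r') (by
        rw [zero_sub, abs_neg, hr']; push_cast
        rw [abs_inv, Nat.abs_cast]
        exact inv_le_one_of_one_le₀ (by exact_mod_cast hMn0))
      rw [abs_zero, mul_pow, hr'den] at h
      have h2 : ((Mden w e r : ℕ) : ℝ) ^ 2 ≤ (wd * (q : ℝ) ^ K) ^ 2 := pow_le_pow_left₀ (Nat.cast_nonneg _) hMn 2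
      calc C₀rat r' ≤ 1280000000 * (0 + 4) * ((27 + 2 * 0) ^ 2 * ((Mden w e r : ℕ) : ℝ) ^ 2) := h
        _ ≤ 1280000000 * (0 + 4) * ((27 + 2 * 0) ^ 2 * (wd * (q : ℝ) ^ K) ^ 2) := by gcongr
        _ = c0 * wd ^ 2 * (q : ℝ) ^ (2 * K) := by rw [hc0]; ring
    have h2 := measure_factor_le hQdeg hnKb h16Y
    have hY0 : 0 < Y := lt_of_lt_of_le (Real.log_pos (by norm_num)) h16Y
    have hC₀0 : 0 ≤ C₀rat r' := by unfold C₀rat; positivity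
    have hKb1 : (1 : ℝ) + (Kb : ℝ) ≤ (1 + cN) * (q : ℝ) ^ (2 * K) := by
      rw [add_mul, one_mul]; linarith [one_le_pow₀ (n := 2 * K) hq1r]
    calc C₀rat r' * (Q.natDegree : ℝ) ^ 2 * Y * (Real.log Y + Real.log Q.natDegree) ^ 2 /
          Real.log Y ^ 2
        = C₀rat r' * ((Q.natDegree : ℝ) ^ 2 * Y * (Real.log Y + Real.log Q.natDegree) ^ 2 /
            Real.log Y ^ 2) := by ring
      _ ≤ (c0 * wd ^ 2 * (q : ℝ) ^ (2 * K)) * ((Kb : ℝ) ^ 2 * (1 + (Kb : ℝ)) ^ 2 * Y) :=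
          mul_le_mul h1 h2 (by positivity) (by positivity)
      _ ≤ (c0 * wd ^ 2 * (q : ℝ) ^ (2 * K)) *
          ((cN * (q : ℝ) ^ (2 * K)) ^ 2 * ((1 + cN) * (q : ℝ) ^ (2 * K)) ^ 2 * (cY * (q : ℝ) ^ (K + 1))) := by
          gcongr
      _ = c * (q : ℝ) ^ (11 * K + 1) := by rw [hc]; ring
  have hlow : Real.exp (-(C₀rat r' * (Q.natDegree : ℝ) ^ 2 * Y *
      (Real.log Y + Real.log Q.natDegree) ^ 2 / Real.log Y ^ 2)) ≤ ‖(x : ℂ) - ξ‖ := hXr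
  -- `η' := (q^D c_G)^𝔐 η < exp(−q^{13K+3})`
  set η' : ℝ := ((q : ℝ) ^ D * cG) ^ (Mden w e r) * η with hη'
  have hη'lt : η' < Real.exp (-((q : ℝ) ^ (13 * K + 3))) := by
    have hXpos : 0 < ((q : ℝ) ^ D * cG) ^ (Mden w e r) := by positivity
    have h1 : η' < Real.exp (wd * (q : ℝ) ^ K * ((D + cG) * q)) * Real.exp (-((q : ℝ) ^ (13 * K + 4))) :=
      calc η' < ((q : ℝ) ^ D * cG) ^ (Mden w e r) * Real.exp (-((q : ℝ) ^ (13 * K + 4))) :=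
            mul_lt_mul_of_pos_left hηlt hXpos
        _ ≤ _ := mul_le_mul_of_nonneg_right hLexp (Real.exp_pos _).le
    rw [← Real.exp_add] at h1
    refine h1.trans_le (Real.exp_le_exp.mpr ?_)
    have e1 : wd * (q : ℝ) ^ K * ((D + cG) * q) = wd * (D + cG) * (q : ℝ) ^ (K + 1) := by ring
    have e2 : (q : ℝ) ^ (K + 1) ≤ (q : ℝ) ^ (13 * K + 3) := pow_le_pow_right₀ hq1r (by omega)
    have e3 : (q : ℝ) ^ (13 * K + 4) = q * (q : ℝ) ^ (13 * K + 3) := by ring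
    have e4 : (wd * (D + cG) + 1) * (q : ℝ) ^ (13 * K + 3) ≤ q * (q : ℝ) ^ (13 * K + 3) :=
      mul_le_mul_of_nonneg_right (hCwd.trans hCq) (by positivity)
    have e5 : wd * (D + cG) * (q : ℝ) ^ (K + 1) ≤ wd * (D + cG) * (q : ℝ) ^ (13 * K + 3) :=
      mul_le_mul_of_nonneg_left e2 hwdc
    rw [e1]; linarith
  have hδ : ‖(x : ℂ) - ξ‖ ^ R₀.natDegree ≤ (q : ℝ) ^ 0 * M * η' := by
    rw [pow_zero, one_mul, hη']
    calc ‖(x : ℂ) - ξ‖ ^ R₀.natDegree ≤ ‖aeval (x : ℂ) R₀‖ := hξle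
      _ ≤ M * ((q : ℝ) ^ D * cG) ^ (Mden w e r) * η := hup
      _ = M * (((q : ℝ) ^ D * cG) ^ (Mden w e r) * η) := by ring
  have hqm : C * (q : ℝ) ^ (11 * K + 1 + 2 * K + 1) ≤ (q : ℝ) ^ (13 * K + 3) :=
    order_budget_gen K (by positivity) hCq
  exact endgame_gen (D := 0) hq1 hc0' hM0 hNA hlow hΦ hδ hη'lt hCend hqm

end MixedEngine

end Summit.Schanuel.Schanuel.Theorems.RootDecomp1ERadixCell

end
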